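import Summits.QuantumFields.BalabanUV.Beta.RemainderExplicitHistoryDiagonalSourceEverywhere
import Summits.QuantumFields.BalabanUV.Beta.RemainderExplicitHistoryDiagonalWindowEverywhere

/-!
# RemainderExplicitHistoryDiagonalLawEverywhere — ROAD P3, ORDER-0 PROFILE FAMILY: THE LAW AT EVERY POSITION FOR THE MATCHED DISCREPANCY —
# LOWER SIDE with the exact weight `ω(a; j₀, K) = min(a,K)(min(a,K) − j₀)₊∕(K√(K−j₀))` at EVERY position of two pinned runs and, for a pinned
# family, at EVERY infrared distance `m ≥ 1` and EVERY cutoff `n` (`astar g m − invSq g m n ≥ (1−Wγ∕b)∕(8κ₂(n+m)√(b₂m)) · Σ_a ρ(a)·min(a,n+m)·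
# (min(a,n+m) − n)₊` — old ages `a ≥ n+m` give `√m·Σ_{a≥n+m}ρ(a)` with NO half restriction, young missing ages `n < a < n+m` give the NEW term
# `a(a−n)∕((n+m)√m)`, the only one alive for profiles of bounded memory); UPPER SIDE with the same weight MODULO THE ULTRAVIOLET FEEDBACK
# (`d_{j₀} ≤ C_w·((4κ∕(K√(b(K−j₀))))Σ_a ρ(a)min(a,K)(min(a,K)−j₀)₊ + Σ_{i<j₀}((g^A_i)³∕2)·d_i·(R(K−i) − R(j₀−i)))`, `C_w = (1−Wγ∕b)∕(1−2Wγ∕b)`)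
# (second file of station S-d4p3-g52-1 «the law at every position»; the third file resolves the feedback by the supersolution principle)

Cell `pub-balaban`, β-function sub-cell, BINDER row D4 «RemainderConst leaves for Bałaban's split» (`HOME/BINDER-OWNERS.md`; owner lineage
`b2b-balaban-beta-an4`; this file by co-owner #3 lineage `b2b-balaban-beta-d4-p3`, road P3 «the reduction road», generation 52, station
S-d4p3-g52-1, second file; imports the station's first file `RemainderExplicitHistoryDiagonalSourceEverywhere` and generation 51's
`RemainderExplicitHistoryDiagonalWindowEverywhere`), β-FLOW TEAM duty (1); FREEZE (0) honoured (def-free module in road P3's own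
`RemainderExplicit*` series; no leaf, no interface, no Literature file).  SOURCE OF THE SHAPES ONLY: [Balaban1987RG1] (0.20) p. 256, (0.31) and
Thm 2 p. 259, §5 p. 298.  [folklore] real analysis about ONE explicit toy family (ours), road P3's ORDER-0 PROFILE FAMILY
`β_{k+1} = b + Σ_{i≤k} ρ(k−i)·min(g_k, |g_k − g_i|)` (generation 44), memory PROFILE `ρ ≥ 0` summable (`Σ_{a<N} ρ_a ≤ W`), `Wγ < b`.
HONEST FRAMING: *"Discharging BetaPertH makes Bałaban's UV stability UNCONDITIONAL — a real constructive-QFT result; it is NOT the continuum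
limit and NOT the Clay problem."*  THIS FILE DISCHARGES NOTHING OF THE KIND; nothing of Bałaban's (1.22) is asserted or constructed; row D4
class UNCHANGED (critical-path width 0; instance 0∕1; D4 DISCHARGE NO DATE); NOT B12 Thm 2, NOT BetaPertH, NOT continuum, NOT Clay.  HONEST
DEPENDENCY: continuum YM on T⁴ ⇐ BetaPertH ∧ nine spine estimates (0/9 proved); BetaPertH ⇐ (D1) ∧ (D4) ∧ CAP+tail; G-an2-4 gates asym, D1
and NE2/3/4.  ABSOLUTE RULE: nothing is cited as a fact.  All letters NOT-IN-PRINT; `BetaFlowAsPrinted S` records a Markov β_n only.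

WHAT IS PROVED ([folklore]; 0 sorry; 0 `def`; two runs A: `K` steps, B: `K + n` steps of the family in ]0,γ], pinned `g^A_K = g^B_{K+n}`;
`d_j = 1∕(g^B_{j+n})² − 1∕(g^A_j)²`, `E_j` = B's extra-age source, `R(k) = Σ_{a<k} ρ(a)`, `κ = (b+Wγ)∕b`, `b₂ = 1∕(g^B_{K+n})² + b + Wγ`, `κ₂ = b₂∕b`).
* §1 PAIR FORMS: **`disc_lower_everywhere`** (`Wγ < b`, `j₀ < K`, `N ≤ j₀+n+1` ⇒ `(1−Wγ∕b)·(8κ₂K√(b₂(K−j₀)))⁻¹·Σ_{a<N} ρ(a)min(a,K)(min(a,K)−j₀)₊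
  ≤ d_{j₀}`); `disc_upper_everywhere_max` (no smallness: `d_{j₀} ≤ (4κ∕(K√(b(K−j₀))))·Σ_{a<K+n} ρ(a)min(a,K)(min(a,K)−j₀)₊ + Σ_{i<j₀} ((g^A_i)³∕2)
  d_i (R(K−i) − R(j₀−i)) + (Wγ∕b)·P` for any bound `P` of `d` on `[j₀,K)`); **`disc_upper_everywhere`** (`2Wγ < b` ⇒ the same with `C_w` and no `P`).
* §2 FAMILY FORMS (pinned family, `b₂ = 1∕g_IR² + b + Wγ`): **`astar_sub_invSq_lower_everywhere`** (every `m ≥ 1`, `n`, `N`: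
  `(1−Wγ∕b)·(8κ₂(n+m)√(b₂m))⁻¹·Σ_{a<N} ρ(a)·min(a,n+m)·(min(a,n+m) − n)₊ ≤ astar g m − invSq g m n`); **`astar_sub_invSq_lower_old`** (the old ages
  alone: `(1−Wγ∕b)√m∕(8κ₂√b₂)·(R(N) − R(n+m)) ≤ astar g m − invSq g m n` — generation 51's `√σ₁·τ′(n+m)`, `2σ₁ ≤ n+m+1`, without the half
  restriction); `astar_sub_invSq_lower_young` (the young missing ages alone: `(1−Wγ∕b)·(8κ₂(n+m)√(b₂m))⁻¹·Σ_{a∈[n+1,n+m)} ρ(a)·a·(a−n) ≤ …`).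
-/

noncomputable section

open Finset Filter Topology

namespace Summit.QuantumFields.BalabanUV.Beta.RemainderExplicitHistoryDiagonalLawEverywhere

open Literature.MathematicalPhysics.QuantumFieldTheory.Balaban1983to89
open Literature.MathematicalPhysics.QuantumFieldTheory.Balaban1983to89.FlowStep
open Literature.MathematicalPhysics.QuantumFieldTheory.Balaban1983to89.T4CouplingMatching
open Literature.MathematicalPhysics.QuantumFieldTheory.Balaban1983to89.T4ContinuumCoupling
open Summit.QuantumFields.BalabanUV.Beta.RemainderExplicitHistoryDiagonalMonotone
open Summit.QuantumFields.BalabanUV.Beta.RemainderExplicitHistoryDiagonalWeights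
open Summit.QuantumFields.BalabanUV.Beta.RemainderExplicitHistoryDiagonalTwoRun
open Summit.QuantumFields.BalabanUV.Beta.RemainderExplicitHistoryDiagonalWindow
open Summit.QuantumFields.BalabanUV.Beta.RemainderExplicitHistoryDiagonalComparison
open Summit.QuantumFields.BalabanUV.Beta.RemainderExplicitHistoryDiagonalWindowEverywhere
open Summit.QuantumFields.BalabanUV.Beta.RemainderExplicitHistoryDiagonalSourceEverywhere

variable {β : HBeta} {b γ W : ℝ} {ρ : ℕ → ℝ}

/-! ## §1 Two pinned runs: the law at every position -/

/-- **THE LOWER LAW AT EVERY POSITION, EXACT WEIGHT** (`Wγ < b`).  Two runs of the order-0 profile family in ]0,γ] (`b > 0`, `γ > 0`, `ρ ≥ 0`,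
`Σ_{a<N} ρ_a ≤ W`, `Wγ < b`) — A: `K` steps, B: `K + n` steps — pinned `g^A_K = g^B_{K+n}`; `b₂ = 1∕(g^B_{K+n})² + (b + Wγ)`, `κ₂ = b₂∕b`.  THEN at EVERY
position `j₀ < K` and for every `N ≤ j₀ + n + 1`:
`(1 − Wγ∕b)·(1∕(8κ₂K√(b₂(K−j₀))))·Σ_{a<N} ρ(a)·min(a,K)·(min(a,K) − j₀)₊ ≤ 1∕(g^B_{j₀+n})² − 1∕(g^A_{j₀})²` — the window source is at least the
weighted missing ages (first file's `le_srcFrom`) and at most `d_{j₀}∕(1 − Wγ∕b)` (generation 49's `window_lower_max` fed with generation 50's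
window maximum `max_disc_le_disc_div`). [cite: Balaban1987RG1, (0.20) p.256, (0.31) and Thm 2 p.259] -/
theorem disc_lower_everywhere
    (hβ : ∀ (k : ℕ) (p : Fin (k + 1) → ℝ),
      β k p = b + ∑ i : Fin (k + 1), ρ (k - i) * min (p (Fin.last k)) (|p (Fin.last k) - p i|))
    (hb : 0 < b) (hγ : 0 < γ) (hρ0 : ∀ a, 0 ≤ ρ a) (hρW : ∀ n, ∑ a ∈ range n, ρ a ≤ W) (hsmall : W * γ < b) {K n : ℕ}
    {gA gB : ℕ → ℝ} (hA : RGEqH K β gA) (hB : RGEqH (K + n) β gB) (hAbox : ∀ k, k ≤ K → 0 < gA k ∧ gA k ≤ γ)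
    (hBbox : ∀ k, k ≤ K + n → 0 < gB k ∧ gB k ≤ γ) (hpin : gA K = gB (K + n)) {j₀ : ℕ} (hj₀K : j₀ < K) {N : ℕ}
    (hN : N ≤ j₀ + n + 1) :
    (1 - W * γ / b) / (8 * ((1 / (gB (K + n)) ^ 2 + (b + W * γ)) / b) * K
          * Real.sqrt ((1 / (gB (K + n)) ^ 2 + (b + W * γ)) * ((K - j₀ : ℕ) : ℝ)))
        * ∑ a ∈ range N, ρ a * (min (a : ℝ) K * ((min a K - j₀ : ℕ) : ℝ))
      ≤ 1 / (gB (j₀ + n)) ^ 2 - 1 / (gA j₀) ^ 2 := by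
  have hApos : ∀ k, k ≤ K → 0 < gA k := fun k hk => (hAbox k hk).1
  have hBpos : ∀ k, k ≤ K + n → 0 < gB k := fun k hk => (hBbox k hk).1
  have hc : 0 < 1 - W * γ / b := by
    have : W * γ / b < 1 := (div_lt_one hb).mpr hsmall
    linarith
  have hsrc := le_srcFrom hβ hb hγ hρ0 hρW hB hBbox hj₀K hN
  have hmax := max_disc_le_disc_div hβ hb hγ hρ0 hρW hsmall hA hB hAbox hBpos hpin j₀
  have hwin := window_lower_max hβ hb hγ hρ0 hρW hA hB hAbox hBbox hpin hj₀K.le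
    (P := (1 / (gB (j₀ + n)) ^ 2 - 1 / (gA j₀) ^ 2) / (1 - W * γ / b))
    (fun i h1 h2 => hmax i (Finset.mem_Icc.mpr ⟨h1, h2⟩))
  set d₀ : ℝ := 1 / (gB (j₀ + n)) ^ 2 - 1 / (gA j₀) ^ 2 with hd₀
  set S : ℝ := ∑ j ∈ Ico j₀ K, ∑ i ∈ range n, ρ (j + n - i) * (gB (j + n) - gB i) with hS
  -- `S ≤ d₀ + x·d₀∕(1−x) = d₀∕(1−x)`, i.e. `(1−x)·S ≤ d₀`
  have e : d₀ + W * γ / b * (d₀ / (1 - W * γ / b)) = d₀ / (1 - W * γ / b) := by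
    rw [eq_div_iff hc.ne', add_mul, mul_assoc, div_mul_cancel₀ _ hc.ne']
    ring
  have hSd : (1 - W * γ / b) * S ≤ d₀ := by
    have h1 : S ≤ d₀ / (1 - W * γ / b) := by linarith [hwin, e]
    have := mul_le_mul_of_nonneg_left h1 hc.le
    rwa [mul_div_cancel₀ _ hc.ne'] at this
  have hpinpos := (hBbox (K + n) le_rfl).1
  have hW : 0 ≤ W := by simpa using hρW 0
  have hKpos : (0 : ℝ) < K := by exact_mod_cast (show 0 < K by omega)
  have hs0pos : (0 : ℝ) < ((K - j₀ : ℕ) : ℝ) := by exact_mod_cast (show 0 < K - j₀ by omega)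
  set B₂ : ℝ := 1 / (gB (K + n)) ^ 2 + (b + W * γ) with hB₂
  have hB₂pos : 0 < B₂ := by rw [hB₂]; positivity
  have e2 : (1 - W * γ / b) / (8 * (B₂ / b) * K * Real.sqrt (B₂ * ((K - j₀ : ℕ) : ℝ)))
        * ∑ a ∈ range N, ρ a * (min (a : ℝ) K * ((min a K - j₀ : ℕ) : ℝ))
      = (1 - W * γ / b) * (1 / (8 * (B₂ / b * K * Real.sqrt (B₂ * ((K - j₀ : ℕ) : ℝ))))
        * ∑ a ∈ range N, ρ a * (min (a : ℝ) K * ((min a K - j₀ : ℕ) : ℝ))) := by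
    have : Real.sqrt (B₂ * ((K - j₀ : ℕ) : ℝ)) ≠ 0 := (Real.sqrt_pos.2 (by positivity)).ne'
    field_simp
  rw [e2]
  calc _ ≤ (1 - W * γ / b) * S := mul_le_mul_of_nonneg_left hsrc hc.le
    _ ≤ d₀ := hSd

/-- **THE UPPER LAW AT EVERY POSITION MODULO THE ULTRAVIOLET FEEDBACK, AGAINST A WINDOW BOUND** (no smallness).  Same two pinned runs in ]0,γ]
(`b > 0`, `γ > 0`, `ρ ≥ 0`, `Σ_{a<N} ρ_a ≤ W`), `κ = (b + Wγ)∕b`; if `d_t ≤ P` (`P ≥ 0`) for all `t ∈ [j₀, K)`, then at every `j₀ < K`: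
`d_{j₀} ≤ (4κ∕(K√(b(K−j₀))))·Σ_{a<K+n} ρ(a)min(a,K)(min(a,K)−j₀)₊ + Σ_{i<j₀} ((g^A_i)³∕2)·d_i·(R(K−i) − R(j₀−i)) + (Wγ∕b)·P` — generation 49's
`window_identity` with the source priced by the first file's `srcFrom_le`, the feedback by generation 51's `uvFeedback_le_cube`, the window's own
term by `inWindow_le_max`. [cite: Balaban1987RG1, (0.20) p.256, (0.31) and Thm 2 p.259] -/
theorem disc_upper_everywhere_max
    (hβ : ∀ (k : ℕ) (p : Fin (k + 1) → ℝ),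
      β k p = b + ∑ i : Fin (k + 1), ρ (k - i) * min (p (Fin.last k)) (|p (Fin.last k) - p i|))
    (hb : 0 < b) (hγ : 0 < γ) (hρ0 : ∀ a, 0 ≤ ρ a) (hρW : ∀ n, ∑ a ∈ range n, ρ a ≤ W) {K n : ℕ} {gA gB : ℕ → ℝ}
    (hA : RGEqH K β gA) (hB : RGEqH (K + n) β gB) (hAbox : ∀ k, k ≤ K → 0 < gA k ∧ gA k ≤ γ)
    (hBbox : ∀ k, k ≤ K + n → 0 < gB k ∧ gB k ≤ γ) (hpin : gA K = gB (K + n)) {j₀ : ℕ} (hj₀K : j₀ < K) {P : ℝ}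
    (hP : ∀ t, j₀ ≤ t → t < K → 1 / (gB (t + n)) ^ 2 - 1 / (gA t) ^ 2 ≤ P) (hP0 : 0 ≤ P) :
    1 / (gB (j₀ + n)) ^ 2 - 1 / (gA j₀) ^ 2
      ≤ 4 * ((b + W * γ) / b) / ((K : ℝ) * Real.sqrt (b * ((K - j₀ : ℕ) : ℝ)))
          * ∑ a ∈ range (K + n), ρ a * ((min (a : ℝ) K) * ((min a K - j₀ : ℕ) : ℝ))
        + ∑ i ∈ range j₀, (gA i) ^ 3 / 2 * (1 / (gB (i + n)) ^ 2 - 1 / (gA i) ^ 2)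
            * (∑ a ∈ range (K - i), ρ a - ∑ a ∈ range (j₀ - i), ρ a)
        + W * γ / b * P := by
  have hApos : ∀ k, k ≤ K → 0 < gA k := fun k hk => (hAbox k hk).1
  have hBpos : ∀ k, k ≤ K + n → 0 < gB k := fun k hk => (hBbox k hk).1
  rw [window_identity hβ hb hρ0 hA hB hApos hBpos hpin hj₀K.le]
  have h1 := srcFrom_le hβ hb hγ hρ0 hρW hB hBbox hj₀K
  have h2 := uvFeedback_le_cube hβ hb hρ0 hA hB hApos hBpos hpin hj₀K.le
  have h3 := inWindow_le_max hβ hb hγ hρ0 hρW hA hB hAbox hBpos hpin hP hP0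
  linarith

/-- **THE UPPER LAW AT EVERY POSITION MODULO THE ULTRAVIOLET FEEDBACK** (`2Wγ < b`).  Same two pinned runs, `Σ_{a<N} ρ_a ≤ W` with `2Wγ < b`;
`C_w = (1 − Wγ∕b)∕(1 − 2Wγ∕b)`, `κ = (b + Wγ)∕b`.  THEN at EVERY position `j₀ < K`:
`d_{j₀} ≤ C_w·((4κ∕(K√(b(K−j₀))))·Σ_{a<K+n} ρ(a)min(a,K)(min(a,K)−j₀)₊ + Σ_{i<j₀} ((g^A_i)³∕2)·d_i·(R(K−i) − R(j₀−i)))` — `disc_upper_everywhere_max` with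
the window bound `P = d_{j₀}∕(1 − Wγ∕b)` (generation 50's `max_disc_le_disc_div`), absorbed. [cite: Balaban1987RG1, (0.20) p.256, (0.31) and Thm 2 p.259] -/
theorem disc_upper_everywhere
    (hβ : ∀ (k : ℕ) (p : Fin (k + 1) → ℝ),
      β k p = b + ∑ i : Fin (k + 1), ρ (k - i) * min (p (Fin.last k)) (|p (Fin.last k) - p i|))
    (hb : 0 < b) (hγ : 0 < γ) (hρ0 : ∀ a, 0 ≤ ρ a) (hρW : ∀ n, ∑ a ∈ range n, ρ a ≤ W) (hsmall2 : 2 * W * γ < b) {K n : ℕ}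
    {gA gB : ℕ → ℝ} (hA : RGEqH K β gA) (hB : RGEqH (K + n) β gB) (hAbox : ∀ k, k ≤ K → 0 < gA k ∧ gA k ≤ γ)
    (hBbox : ∀ k, k ≤ K + n → 0 < gB k ∧ gB k ≤ γ) (hpin : gA K = gB (K + n)) {j₀ : ℕ} (hj₀K : j₀ < K) :
    1 / (gB (j₀ + n)) ^ 2 - 1 / (gA j₀) ^ 2
      ≤ (1 - W * γ / b) / (1 - 2 * W * γ / b)
        * (4 * ((b + W * γ) / b) / ((K : ℝ) * Real.sqrt (b * ((K - j₀ : ℕ) : ℝ)))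
            * ∑ a ∈ range (K + n), ρ a * ((min (a : ℝ) K) * ((min a K - j₀ : ℕ) : ℝ))
          + ∑ i ∈ range j₀, (gA i) ^ 3 / 2 * (1 / (gB (i + n)) ^ 2 - 1 / (gA i) ^ 2)
              * (∑ a ∈ range (K - i), ρ a - ∑ a ∈ range (j₀ - i), ρ a)) := by
  have hApos : ∀ k, k ≤ K → 0 < gA k := fun k hk => (hAbox k hk).1
  have hBpos : ∀ k, k ≤ K + n → 0 < gB k := fun k hk => (hBbox k hk).1
  have hW : 0 ≤ W := by simpa using hρW 0
  have hx0 : 0 ≤ W * γ / b := by positivity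
  have hsmall : W * γ < b := by nlinarith
  have hx1 : W * γ / b < 1 := (div_lt_one hb).mpr hsmall
  have hx2 : 2 * W * γ / b < 1 := (div_lt_one hb).mpr hsmall2
  have hc : 0 < 1 - W * γ / b := by linarith
  have hc2 : 0 < 1 - 2 * W * γ / b := by linarith
  set d₀ : ℝ := 1 / (gB (j₀ + n)) ^ 2 - 1 / (gA j₀) ^ 2 with hd₀
  have hd₀0 : 0 ≤ d₀ := by
    have := invSq_le_invSq_shift_run hβ hb hρ0 hA hB hApos hBpos hpin j₀ hj₀K.le
    rw [hd₀]; linarith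
  have hmax := max_disc_le_disc_div hβ hb hγ hρ0 hρW hsmall hA hB hAbox hBpos hpin j₀
  have h := disc_upper_everywhere_max hβ hb hγ hρ0 hρW hA hB hAbox hBbox hpin hj₀K (P := d₀ / (1 - W * γ / b))
    (fun t h1 h2 => hmax t (Finset.mem_Icc.mpr ⟨h1, h2.le⟩)) (div_nonneg hd₀0 hc.le)
  set S : ℝ := 4 * ((b + W * γ) / b) / ((K : ℝ) * Real.sqrt (b * ((K - j₀ : ℕ) : ℝ)))
      * ∑ a ∈ range (K + n), ρ a * ((min (a : ℝ) K) * ((min a K - j₀ : ℕ) : ℝ)) with hS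
  set F : ℝ := ∑ i ∈ range j₀, (gA i) ^ 3 / 2 * (1 / (gB (i + n)) ^ 2 - 1 / (gA i) ^ 2)
      * (∑ a ∈ range (K - i), ρ a - ∑ a ∈ range (j₀ - i), ρ a) with hF
  -- `d₀ ≤ S + F + x·d₀∕(1−x)` ⇒ `d₀·(1−2x)∕(1−x) ≤ S + F`
  have key : d₀ * (1 - 2 * W * γ / b) ≤ (1 - W * γ / b) * (S + F) := by
    have h' : d₀ * (1 - W * γ / b) ≤ (S + F) * (1 - W * γ / b) + W * γ / b * d₀ := by
      have := mul_le_mul_of_nonneg_right h hc.le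
      have e : W * γ / b * (d₀ / (1 - W * γ / b)) * (1 - W * γ / b) = W * γ / b * d₀ := by
        rw [mul_assoc, div_mul_cancel₀ _ hc.ne']
      calc d₀ * (1 - W * γ / b) ≤ (S + F + W * γ / b * (d₀ / (1 - W * γ / b))) * (1 - W * γ / b) := this
        _ = (S + F) * (1 - W * γ / b) + W * γ / b * d₀ := by rw [add_mul, e]
    have e2 : d₀ * (1 - 2 * W * γ / b) = d₀ * (1 - W * γ / b) - W * γ / b * d₀ := by ring
    rw [e2]
    linarith
  rw [div_mul_eq_mul_div, le_div_iff₀ hc2]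
  linarith

/-! ## §2 A pinned family of runs: the lower law at every infrared distance and every cutoff -/

/-- **ROAD P3 — THE RATE IN THE CUTOFF, LOWER SIDE WITH THE EXACT WEIGHT, EVERYWHERE** (`Wγ < b`).  A family `K ↦ g K` of runs of the order-0
profile family in ]0,γ] pinned at one `g_IR` (`b > 0`, `γ > 0`, `ρ ≥ 0`, `Σ_{a<N} ρ_a ≤ W`, `Wγ < b`); `b₂ = 1∕g_IR² + (b + Wγ)`, `κ₂ = b₂∕b`.  THEN for
EVERY infrared distance `m ≥ 1`, EVERY cutoff `n` and every `N`:
`(1 − Wγ∕b)·(1∕(8κ₂(n+m)√(b₂m)))·Σ_{a<N} ρ(a)·min(a,n+m)·(min(a,n+m) − n)₊ ≤ astar g m − invSq g m n` — the pair (run `n+m`, run `n+m+N`) at the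
position `n` (`disc_lower_everywhere`), then `invSq g m (n+N) ≤ astar g m` by monotonicity in the cutoff (generation 47's `invSq_mono` ∕
`continuum_monotone`).  Old ages `a ≥ n+m` weigh `(n+m)·m`, young missing ages `n < a < n+m` weigh `a·(a−n)`, present ages `a ≤ n` nothing.
[cite: Balaban1987RG1, (0.20) p.256, (0.31) and Thm 2 p.259] -/
theorem astar_sub_invSq_lower_everywhere
    (hβ : ∀ (k : ℕ) (p : Fin (k + 1) → ℝ),
      β k p = b + ∑ i : Fin (k + 1), ρ (k - i) * min (p (Fin.last k)) (|p (Fin.last k) - p i|))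
    (hb : 0 < b) (hγ : 0 < γ) (hρ0 : ∀ a, 0 ≤ ρ a) (hρW : ∀ n, ∑ a ∈ range n, ρ a ≤ W) (hsmall : W * γ < b)
    {g : ℕ → ℕ → ℝ} {gIR : ℝ} (hrun : ∀ K, RGEqH K β (g K)) (hbox : ∀ K i, i ≤ K → 0 < g K i ∧ g K i ≤ γ)
    (hpin : ∀ K, g K K = gIR) {m : ℕ} (hm : 1 ≤ m) (n N : ℕ) :
    (1 - W * γ / b) / (8 * ((1 / gIR ^ 2 + (b + W * γ)) / b) * ((n + m : ℕ) : ℝ)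
          * Real.sqrt ((1 / gIR ^ 2 + (b + W * γ)) * (m : ℝ)))
        * ∑ a ∈ range N, ρ a * (min (a : ℝ) ((n + m : ℕ) : ℝ) * ((min a (n + m) - n : ℕ) : ℝ))
      ≤ astar g m - invSq g m n := by
  have hA : RGEqH (n + m) β (g (n + m)) := hrun (n + m)
  have hB : RGEqH (n + m + N) β (g (n + m + N)) := hrun (n + m + N)
  have hpin' : g (n + m) (n + m) = g (n + m + N) (n + m + N) := by rw [hpin, hpin]
  have h := disc_lower_everywhere hβ hb hγ hρ0 hρW hsmall hA hB (hbox (n + m)) (hbox (n + m + N)) hpin'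
    (j₀ := n) (by omega) (N := N) (by omega)
  rw [hpin, show n + m - n = m by omega] at h
  have hmono := invSq_mono hβ hb hρ0 hrun hbox hpin m
  have ht := (continuum_monotone hβ hb hγ hρ0 hρW hrun hbox hpin).1 m
  have e1 : 1 / (g (n + m + N) (n + N)) ^ 2 = invSq g m (n + N) := by
    rw [invSq_def, show n + N + m = n + m + N by omega]
  have e2 : 1 / (g (n + m) n) ^ 2 = invSq g m n := by rw [invSq_def]
  rw [e1, e2] at h
  have hlim : invSq g m (n + N) ≤ astar g m := hmono.ge_of_tendsto ht (n + N)
  linarith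

/-- **THE OLD AGES ALONE: `√m` TIMES THE TAIL BEYOND THE RUN, FOR EVERY `(m, n)`** (`Wγ < b`).  Same pinned family; for every `m ≥ 1`, `n`, `N`:
`(1 − Wγ∕b)·√m∕(8κ₂√b₂)·(Σ_{a<N} ρ(a) − Σ_{a<n+m} ρ(a)) ≤ astar g m − invSq g m n` — every age `a ≥ n + m` is missing at all `m` window positions
and weighs `(n+m)·m`.  Generations 49–51 had `√σ₁·τ′(n+m)` only for infrared-half distances `2σ₁ ≤ n+m+1`; here no half restriction is left.
[cite: Balaban1987RG1, (0.20) p.256, (0.31) and Thm 2 p.259] -/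
theorem astar_sub_invSq_lower_old
    (hβ : ∀ (k : ℕ) (p : Fin (k + 1) → ℝ),
      β k p = b + ∑ i : Fin (k + 1), ρ (k - i) * min (p (Fin.last k)) (|p (Fin.last k) - p i|))
    (hb : 0 < b) (hγ : 0 < γ) (hρ0 : ∀ a, 0 ≤ ρ a) (hρW : ∀ n, ∑ a ∈ range n, ρ a ≤ W) (hsmall : W * γ < b)
    {g : ℕ → ℕ → ℝ} {gIR : ℝ} (hrun : ∀ K, RGEqH K β (g K)) (hbox : ∀ K i, i ≤ K → 0 < g K i ∧ g K i ≤ γ)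
    (hpin : ∀ K, g K K = gIR) {m : ℕ} (hm : 1 ≤ m) (n N : ℕ) :
    (1 - W * γ / b) * Real.sqrt (m : ℝ) / (8 * ((1 / gIR ^ 2 + (b + W * γ)) / b) * Real.sqrt (1 / gIR ^ 2 + (b + W * γ)))
        * (∑ a ∈ range N, ρ a - ∑ a ∈ range (n + m), ρ a)
      ≤ astar g m - invSq g m n := by
  have hW : 0 ≤ W := by simpa using hρW 0
  have hgIR : 0 < gIR := by have := (hbox 0 0 le_rfl).1; rwa [hpin] at this
  have hc : 0 < 1 - W * γ / b := by
    have : W * γ / b < 1 := (div_lt_one hb).mpr hsmall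
    linarith
  set b₂ : ℝ := 1 / gIR ^ 2 + (b + W * γ) with hb₂
  have hb₂pos : 0 < b₂ := by rw [hb₂]; positivity
  have hmpos : (0 : ℝ) < m := by exact_mod_cast hm
  have hKpos : (0 : ℝ) < ((n + m : ℕ) : ℝ) := by exact_mod_cast (show 0 < n + m by omega)
  have h := astar_sub_invSq_lower_everywhere hβ hb hγ hρ0 hρW hsmall hrun hbox hpin hm n N
  -- nonnegativity of `astar − invSq` (for the case `N ≤ n + m`)
  have hmono := invSq_mono hβ hb hρ0 hrun hbox hpin m
  have ht := (continuum_monotone hβ hb hγ hρ0 hρW hrun hbox hpin).1 m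
  have h0 : 0 ≤ astar g m - invSq g m n := by linarith [hmono.ge_of_tendsto ht n]
  by_cases hNK : N ≤ n + m
  · have hneg : ∑ a ∈ range N, ρ a - ∑ a ∈ range (n + m), ρ a ≤ 0 := by
      linarith [Finset.sum_le_sum_of_subset_of_nonneg (Finset.range_mono hNK) fun a _ _ => hρ0 a]
    exact le_trans (mul_nonpos_of_nonneg_of_nonpos (by positivity) hneg) h0
  rw [not_le] at hNK
  -- the old ages `a ∈ [n+m, N)` weigh `(n+m)·m` each
  have hsum : ((n + m : ℕ) : ℝ) * m * (∑ a ∈ range N, ρ a - ∑ a ∈ range (n + m), ρ a)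
      ≤ ∑ a ∈ range N, ρ a * (min (a : ℝ) ((n + m : ℕ) : ℝ) * ((min a (n + m) - n : ℕ) : ℝ)) := by
    rw [← Finset.sum_sdiff (Finset.range_mono hNK.le), add_sub_cancel_right, Finset.mul_sum]
    have hold : ∀ a ∈ range N \ range (n + m), ((n + m : ℕ) : ℝ) * m * ρ a
        = ρ a * (min (a : ℝ) ((n + m : ℕ) : ℝ) * ((min a (n + m) - n : ℕ) : ℝ)) := by
      intro a ha
      have ha' : n + m ≤ a := by
        have := (Finset.mem_sdiff.mp ha).2
        rw [Finset.mem_range, not_lt] at this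
        exact this
      rw [min_eq_right (by exact_mod_cast ha'), min_eq_right ha', show n + m - n = m by omega]
      ring
    rw [Finset.sum_congr rfl hold]
    exact Finset.sum_le_sum_of_subset_of_nonneg Finset.sdiff_subset fun a _ _ =>
      mul_nonneg (hρ0 a) (mul_nonneg (le_min (Nat.cast_nonneg a) hKpos.le) (Nat.cast_nonneg _))
  have hconst : 0 ≤ (1 - W * γ / b) / (8 * (b₂ / b) * ((n + m : ℕ) : ℝ) * Real.sqrt (b₂ * (m : ℝ))) := by
    positivity
  have h2 := mul_le_mul_of_nonneg_left hsum hconst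
  -- `√m∕(8κ₂√b₂) = (n+m)·m ∕ (8κ₂(n+m)√(b₂m))`
  set s : ℝ := Real.sqrt (m : ℝ) with hs_def
  have hs0 : 0 < s := Real.sqrt_pos.2 hmpos
  have hss : (m : ℝ) = s * s := (Real.mul_self_sqrt hmpos.le).symm
  have hsb0 : 0 < Real.sqrt b₂ := Real.sqrt_pos.2 hb₂pos
  have e : (1 - W * γ / b) * s / (8 * (b₂ / b) * Real.sqrt b₂) * (∑ a ∈ range N, ρ a - ∑ a ∈ range (n + m), ρ a)
      = (1 - W * γ / b) / (8 * (b₂ / b) * ((n + m : ℕ) : ℝ) * Real.sqrt (b₂ * (m : ℝ)))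
        * (((n + m : ℕ) : ℝ) * m * (∑ a ∈ range N, ρ a - ∑ a ∈ range (n + m), ρ a)) := by
    rw [Real.sqrt_mul hb₂pos.le, ← hs_def, hss]
    field_simp
  rw [e]
  exact h2.trans h

/-- **THE YOUNG MISSING AGES ALONE** (`Wγ < b`).  Same pinned family; for every `m ≥ 1`, `n`:
`(1 − Wγ∕b)·(1∕(8κ₂(n+m)√(b₂m)))·Σ_{a∈[n+1,n+m)} ρ(a)·a·(a − n) ≤ astar g m − invSq g m n` — an age `a` between the cutoff and the run length is
missing at its `a − n` ultraviolet-most window positions and costs `a∕((n+m)√m)`-ish there; this is the ONLY term alive for a profile of bounded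
memory `A` once `n < A < n + m` (no tail beyond the run), a regime where generations 48–51 say nothing. [cite: Balaban1987RG1, (0.20) p.256, (0.31) and Thm 2 p.259] -/
theorem astar_sub_invSq_lower_young
    (hβ : ∀ (k : ℕ) (p : Fin (k + 1) → ℝ),
      β k p = b + ∑ i : Fin (k + 1), ρ (k - i) * min (p (Fin.last k)) (|p (Fin.last k) - p i|))
    (hb : 0 < b) (hγ : 0 < γ) (hρ0 : ∀ a, 0 ≤ ρ a) (hρW : ∀ n, ∑ a ∈ range n, ρ a ≤ W) (hsmall : W * γ < b)
    {g : ℕ → ℕ → ℝ} {gIR : ℝ} (hrun : ∀ K, RGEqH K β (g K)) (hbox : ∀ K i, i ≤ K → 0 < g K i ∧ g K i ≤ γ)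
    (hpin : ∀ K, g K K = gIR) {m : ℕ} (hm : 1 ≤ m) (n : ℕ) :
    (1 - W * γ / b) / (8 * ((1 / gIR ^ 2 + (b + W * γ)) / b) * ((n + m : ℕ) : ℝ)
          * Real.sqrt ((1 / gIR ^ 2 + (b + W * γ)) * (m : ℝ)))
        * ∑ a ∈ Ico (n + 1) (n + m), ρ a * ((a : ℝ) * ((a - n : ℕ) : ℝ))
      ≤ astar g m - invSq g m n := by
  have hW : 0 ≤ W := by simpa using hρW 0
  have hgIR : 0 < gIR := by have := (hbox 0 0 le_rfl).1; rwa [hpin] at this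
  have hc : 0 < 1 - W * γ / b := by
    have : W * γ / b < 1 := (div_lt_one hb).mpr hsmall
    linarith
  have hKpos : (0 : ℝ) < ((n + m : ℕ) : ℝ) := by exact_mod_cast (show 0 < n + m by omega)
  have h := astar_sub_invSq_lower_everywhere hβ hb hγ hρ0 hρW hsmall hrun hbox hpin hm n (n + m)
  have hsum : ∑ a ∈ Ico (n + 1) (n + m), ρ a * ((a : ℝ) * ((a - n : ℕ) : ℝ))
      ≤ ∑ a ∈ range (n + m), ρ a * (min (a : ℝ) ((n + m : ℕ) : ℝ) * ((min a (n + m) - n : ℕ) : ℝ)) := by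
    have hsub : Ico (n + 1) (n + m) ⊆ range (n + m) := fun a ha => by
      rw [Finset.mem_range]; exact (Finset.mem_Ico.mp ha).2
    rw [← Finset.sum_sdiff hsub]
    have hyoung : ∀ a ∈ Ico (n + 1) (n + m), ρ a * ((a : ℝ) * ((a - n : ℕ) : ℝ))
        = ρ a * (min (a : ℝ) ((n + m : ℕ) : ℝ) * ((min a (n + m) - n : ℕ) : ℝ)) := by
      intro a ha
      have ha' := (Finset.mem_Ico.mp ha).2
      rw [min_eq_left (by exact_mod_cast ha'.le), min_eq_left ha'.le]
    rw [Finset.sum_congr rfl hyoung]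
    have h0 : 0 ≤ ∑ a ∈ range (n + m) \ Ico (n + 1) (n + m),
        ρ a * (min (a : ℝ) ((n + m : ℕ) : ℝ) * ((min a (n + m) - n : ℕ) : ℝ)) :=
      Finset.sum_nonneg fun a _ =>
        mul_nonneg (hρ0 a) (mul_nonneg (le_min (Nat.cast_nonneg a) hKpos.le) (Nat.cast_nonneg _))
    linarith
  exact le_trans (mul_le_mul_of_nonneg_left hsum (by positivity)) h

end Summit.QuantumFields.BalabanUV.Beta.RemainderExplicitHistoryDiagonalLawEverywhere

end
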